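import Summits.AtomisticToContinuum.FouriersLaw.Theorems.BondHeatUncertaintySubdiffusiveBondHeatKernelGibbsA
import Literature.MathematicalPhysics.KineticTheory.LangevinChainEnergyIdentity
import Literature.MathematicalPhysics.KineticTheory.LangevinChainGibbs
import Literature.MathematicalPhysics.KineticTheory.ConfinedDuality

/-!
# The closed pinned chain: Hamiltonian flow, energy conservation, momentum-reversal symmetry, Liouville

Support file for item `stmt-AtomisticToContinuum-9139` (`OddSectorIrreversibility.OddCorrectorDecay`), negative
side, line `odd-persistence-light-cone`. The CLOSED chain is `pinnedChain ω₂ lam β 0` (zero bath coupling: no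
friction, no noise, same Hamiltonian `H`); its pathwise flow `φ_t x = (pinnedChain ω₂ lam β 0).chainFlow N x 0 t`
(`LangevinChainSDE.lean`, zero noise path) is the Hamiltonian flow of `H`. We prove the classical mechanics the
odd-persistence argument consumes (`ω₂ > 0`, `lam, β ≥ 0`):
* `closedChainFlow_eq_drivenFlow` — `φ` is the `drivenFlow` of the model-free pipeline (`ConfinedForcedFlow.lean`);
* `hamiltonian_closedChainFlow` — energy conservation `H(φ_t x) = H(x)` (`pinnedChain_hamiltonian_chainFlow_eq`);
* `closedChainFlow_add` — the flow property `φ_{s+t} = φ_t ∘ φ_s` (`s, t ≥ 0`);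
* `drift_momentumReversal`, `closedChainFlow_reverse` — `Y(Θx) = -Θ(Yx)` for the frictionless drift, hence the
  reversed-drift flow is `Θ ∘ φ_t ∘ Θ` (`Θ(q,p) = (q,-p)`), and the REVERSIBILITY identities
  `Θ(φ_t(Θ(φ_t x))) = x`, `φ_t(Θ(φ_t(Θ x))) = x` (`ConfinedFlowReversal.lean`);
* `map_closedChainFlow_volume` — Liouville: `φ_t` preserves Lebesgue measure (`ConfinedFlowJacobian.map_flow_volume`,
  divergence `-2γ = 0`), and `measurePreserving_closedChainFlow_gibbsWeight` — `φ_t` preserves every Gibbs weight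
  `e^{-H/T} dq dp`; likewise `measurePreserving_momentumReversal_gibbsWeight`.
No new definitions: the flow is written `(pinnedChain ω₂ lam β 0).chainFlow N x 0 t` throughout.
-/

noncomputable section

open MeasureTheory Filter Topology Set Function
open scoped NNReal ENNReal ContDiff
open Literature.MathematicalPhysics.KineticTheory Literature.MathematicalPhysics.KineticTheory.HeatConduction
open Literature.Analysis.ODE OscillatorChain
open Summit.AtomisticToContinuum.FouriersLaw.Theorems.SubdiffusiveBondHeat (pinnedChain_isConfining)

namespace Summit.AtomisticToContinuum.FouriersLaw.Theorems.ClosedChainFlow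

/-- The zero momentum-noise path is continuous (trivial helper fixing the implicit noise argument of the
`chainFlow` API to the literal `0`). [folklore] -/
theorem continuous_zeroNoise (N : ℕ) : Continuous (0 : ℝ → Fin N → ℝ) := continuous_const

/-! ### The frictionless drift and momentum reversal -/

section Drift

variable (ω₂ lam β : ℝ) (N : ℕ)

/-- The drift of the closed chain has no friction term: `Y(q,p) = (p, -∇_q H)`. [folklore] -/
theorem drift_closed_apply (x : PhaseSpace N) :
    (pinnedChain ω₂ lam β 0).drift N x =
      (x.2, fun i => -partialQ i ((pinnedChain ω₂ lam β 0).hamiltonian N) x) := by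
  have hγ : (pinnedChain ω₂ lam β 0).γ = 0 := rfl
  simp only [OscillatorChain.drift, hγ, zero_mul, sub_zero]

/-- `∂_{q_i} H` is even in the momenta. [folklore] -/
theorem partialQ_hamiltonian_momentumReversal (P : OscillatorChain) (x : PhaseSpace N) (i : Fin N) :
    partialQ i (P.hamiltonian N) (x.1, -x.2) = partialQ i (P.hamiltonian N) x := by
  rw [P.partialQ_hamiltonian_eq, P.partialQ_hamiltonian_eq]

/-- **The frictionless drift is `Θ`-antisymmetric**: `Y(q,-p) = -Θ(Y(q,p))`, i.e.
`Y(Θx) = (-(Yx).1, (Yx).2)`. [folklore] -/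
theorem drift_momentumReversal (x : PhaseSpace N) :
    (pinnedChain ω₂ lam β 0).drift N (x.1, -x.2) =
      (-((pinnedChain ω₂ lam β 0).drift N x).1, ((pinnedChain ω₂ lam β 0).drift N x).2) := by
  rw [drift_closed_apply, drift_closed_apply]
  simp only [partialQ_hamiltonian_momentumReversal]

end Drift

/-! ### The closed flow is the driven flow of the pipeline; energy conservation; flow property -/

section Flow

variable {ω₂ lam β : ℝ} (hω : 0 < ω₂) (hl : 0 ≤ lam) (hβ : 0 ≤ β) (N : ℕ)
include hω hl hβ

omit hω hl hβ in
/-- The closed flow is the model-free `drivenFlow` of the frictionless drift with the zero noise path.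
[folklore] -/
theorem closedChainFlow_eq_drivenFlow (x : PhaseSpace N) (t : ℝ) :
    (pinnedChain ω₂ lam β 0).chainFlow N x 0 t = drivenFlow ((pinnedChain ω₂ lam β 0).drift N) x 0 t := by
  unfold OscillatorChain.chainFlow drivenFlow OscillatorChain.truncSol drivenTruncSol OscillatorChain.forcing
  rfl

omit hω hl hβ in
/-- For `t ≤ 0` the closed flow is the identity. [folklore] -/
theorem closedChainFlow_of_nonpos (x : PhaseSpace N) {t : ℝ} (ht : t ≤ 0) :
    (pinnedChain ω₂ lam β 0).chainFlow N x 0 t = x := by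
  rw [pinnedChain_chainFlow_of_nonpos ω₂ lam β 0 N x (continuous_zeroNoise N) ht]
  simp

omit hω hl hβ in
/-- `φ_0 = id`. [folklore] -/
theorem closedChainFlow_zero (x : PhaseSpace N) : (pinnedChain ω₂ lam β 0).chainFlow N x 0 0 = x :=
  closedChainFlow_of_nonpos N x le_rfl

/-- **Energy conservation** along the closed flow: `H(φ_t x) = H(x)`. [folklore] -/
theorem hamiltonian_closedChainFlow (x : PhaseSpace N) (t : ℝ) :
    (pinnedChain ω₂ lam β 0).hamiltonian N ((pinnedChain ω₂ lam β 0).chainFlow N x 0 t) =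
      (pinnedChain ω₂ lam β 0).hamiltonian N x := by
  rcases le_or_gt t 0 with ht | ht
  · rw [closedChainFlow_of_nonpos N x ht]
  · rw [pinnedChain_hamiltonian_chainFlow_eq hω hl hβ le_rfl N x (continuous_zeroNoise N) ht.le]
    have hγ : (pinnedChain ω₂ lam β 0).γ = 0 := rfl
    simp [OscillatorChain.noiseWork, OscillatorChain.dissipation, hγ]

/-- **The flow property** `φ_{s+t} x = φ_t (φ_s x)` for `s, t ≥ 0`. [folklore] -/
theorem closedChainFlow_add (x : PhaseSpace N) {s t : ℝ} (hs : 0 ≤ s) (ht : 0 ≤ t) :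
    (pinnedChain ω₂ lam β 0).chainFlow N x 0 (s + t) =
      (pinnedChain ω₂ lam β 0).chainFlow N ((pinnedChain ω₂ lam β 0).chainFlow N x 0 s) 0 t := by
  rw [pinnedChain_chainFlow_add hω hl hβ le_rfl N x (continuous_zeroNoise N) hs ht]
  congr 1
  funext r
  simp

/-- The closed flow is continuous in time. [folklore] -/
theorem continuous_closedChainFlow (x : PhaseSpace N) :
    Continuous fun t => (pinnedChain ω₂ lam β 0).chainFlow N x 0 t :=
  pinnedChain_continuous_chainFlow hω hl hβ le_rfl N x (continuous_zeroNoise N)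

/-- The closed flow is continuous in the initial condition. [folklore] -/
theorem continuous_closedChainFlow_left (t : ℝ) :
    Continuous fun x => (pinnedChain ω₂ lam β 0).chainFlow N x 0 t :=
  pinnedChain_continuous_chainFlow_left hω hl hβ le_rfl N (continuous_zeroNoise N) t

/-- The closed flow is jointly measurable in `(t, x)`. [folklore] -/
theorem measurable_uncurry_closedChainFlow :
    Measurable fun p : ℝ × PhaseSpace N => (pinnedChain ω₂ lam β 0).chainFlow N p.2 0 p.1 :=
  measurable_uncurry_of_continuous_of_measurable
    (u := fun (t : ℝ) (x : PhaseSpace N) => (pinnedChain ω₂ lam β 0).chainFlow N x 0 t)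
    (fun x => continuous_closedChainFlow hω hl hβ N x)
    (fun t => (continuous_closedChainFlow_left hω hl hβ N t).measurable)

end Flow

/-! ### Momentum reversal conjugates the flow to the reversed-drift flow; reversibility -/

section Reversal

variable {ω₂ lam β : ℝ} (hω : 0 < ω₂) (hl : 0 ≤ lam) (hβ : 0 ≤ β) (N : ℕ)
include hω hl hβ

omit hω hl hβ in
/-- Momentum reversal as a continuous linear map `Θ(q,p) = (q,-p)`. [folklore] -/
theorem momentumReversal_eq_clm (x : PhaseSpace N) :
    ((ContinuousLinearMap.fst ℝ (Fin N → ℝ) (Fin N → ℝ)).prod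
        (-ContinuousLinearMap.snd ℝ (Fin N → ℝ) (Fin N → ℝ))) x = (x.1, -x.2) := by
  simp

/-- **The reversed-drift flow is the `Θ`-conjugate of the flow**: for `t ≥ 0`,
`drivenFlow (-Y) y 0 t = Θ (φ_t (Θ y))` (`Θ(q,p) = (q,-p)`): `s ↦ Θ φ_s Θ y` solves the reversed
integral equation since `Θ ∘ Y = -Y ∘ Θ`. [folklore] -/
theorem drivenFlow_neg_drift_eq (y : PhaseSpace N) {t : ℝ} (ht : 0 ≤ t) :
    drivenFlow (fun z => -(pinnedChain ω₂ lam β 0).drift N z) y 0 t =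
      (((pinnedChain ω₂ lam β 0).chainFlow N (y.1, -y.2) 0 t).1,
        -((pinnedChain ω₂ lam β 0).chainFlow N (y.1, -y.2) 0 t).2) := by
  have hC : (pinnedChain ω₂ lam β 0).IsConfining := pinnedChain_isConfining hω hl hβ le_rfl
  let θL : PhaseSpace N →L[ℝ] PhaseSpace N :=
    (ContinuousLinearMap.fst ℝ (Fin N → ℝ) (Fin N → ℝ)).prod (-ContinuousLinearMap.snd ℝ (Fin N → ℝ) (Fin N → ℝ))
  have hθ : ∀ x : PhaseSpace N, θL x = (x.1, -x.2) := momentumReversal_eq_clm N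
  have hφc : Continuous fun s => (pinnedChain ω₂ lam β 0).chainFlow N (y.1, -y.2) 0 s :=
    continuous_closedChainFlow hω hl hβ N _
  have hYc : Continuous ((pinnedChain ω₂ lam β 0).drift N) :=
    (pinnedChain_contDiff_drift ω₂ lam β 0 N (n := 0)).continuous
  have hzc : Continuous fun s => θL ((pinnedChain ω₂ lam β 0).chainFlow N (y.1, -y.2) 0 s) :=
    θL.continuous.comp hφc
  -- `s ↦ Θ φ_s Θ y` solves the reversed integral equation
  have hsol : IsIntegralSolutionOn (fun z => -(pinnedChain ω₂ lam β 0).drift N z)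
      (fun s => y + (0 : ℝ → PhaseSpace N) s)
      (fun s => θL ((pinnedChain ω₂ lam β 0).chainFlow N (y.1, -y.2) 0 s)) t := by
    intro s hs
    have hφ := pinnedChain_isIntegralSolutionOn_chainFlow hω hl hβ le_rfl N (y.1, -y.2)
      (continuous_zeroNoise N) t s hs
    have hint : IntervalIntegrable
        (fun u => (pinnedChain ω₂ lam β 0).drift N ((pinnedChain ω₂ lam β 0).chainFlow N (y.1, -y.2) 0 u))
        volume 0 s := (hYc.comp hφc).intervalIntegrable _ _
    have hforc : OscillatorChain.forcing (y.1, -y.2) (0 : ℝ → Fin N → ℝ) s = (y.1, -y.2) := by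
      simp [OscillatorChain.forcing]
    have h1 : θL (y.1, -y.2) = y := by rw [hθ]; simp
    have h2 : ∀ u, θL ((pinnedChain ω₂ lam β 0).drift N ((pinnedChain ω₂ lam β 0).chainFlow N (y.1, -y.2) 0 u)) =
        -(pinnedChain ω₂ lam β 0).drift N (θL ((pinnedChain ω₂ lam β 0).chainFlow N (y.1, -y.2) 0 u)) := by
      intro u
      rw [hθ, hθ, drift_momentumReversal ω₂ lam β N]
      ext i <;> simp
    beta_reduce
    rw [hφ, hforc, map_add, ← θL.intervalIntegral_comp_comm hint, h1, Pi.zero_apply, add_zero]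
    congr 1
    exact intervalIntegral.integral_congr fun u _ => h2 u
  have heq := (hC.reversedDrift N).toConfinedDrift.eqOn_flow y continuous_const
    (fun _ => Submodule.zero_mem _) hsol hzc ⟨ht, le_rfl⟩
  simp only [hθ] at heq
  exact heq.symm

/-- **Reversibility, I**: `Θ (φ_t (Θ (φ_t x))) = x` for `t ≥ 0` (the reversed flow undoes the flow).
[folklore] -/
theorem momentumReversal_closedChainFlow_momentumReversal_closedChainFlow (x : PhaseSpace N) {t : ℝ}
    (ht : 0 ≤ t) :
    ((((pinnedChain ω₂ lam β 0).chainFlow N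
        (((pinnedChain ω₂ lam β 0).chainFlow N x 0 t).1, -((pinnedChain ω₂ lam β 0).chainFlow N x 0 t).2)
        0 t).1),
      -(((pinnedChain ω₂ lam β 0).chainFlow N
        (((pinnedChain ω₂ lam β 0).chainFlow N x 0 t).1, -((pinnedChain ω₂ lam β 0).chainFlow N x 0 t).2)
        0 t).2)) = x := by
  set P := pinnedChain ω₂ lam β 0 with hP
  have hC : P.IsConfining := pinnedChain_isConfining hω hl hβ le_rfl
  set D : ConfinedDrift (P.drift N) := (hC.confinedDrift N).toConfinedDrift
  set D' : ConfinedDrift (fun z => -P.drift N z) := (hC.reversedDrift N).toConfinedDrift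
  have h := D.flow_reverse_apply D' (fun _ => rfl) x (n := 0) continuous_const
    (fun _ => Submodule.zero_mem _) (fun _ => Submodule.zero_mem _) rfl ht
  have hrp : reversePath (0 : ℝ → PhaseSpace N) t = 0 := by funext s; simp
  rw [hrp, ← closedChainFlow_eq_drivenFlow, drivenFlow_neg_drift_eq hω hl hβ N _ ht] at h
  exact h

/-- **Reversibility, II**: `φ_t (Θ (φ_t (Θ x))) = x` for `t ≥ 0` (the flow undoes the reversed flow).
[folklore] -/
theorem closedChainFlow_momentumReversal_closedChainFlow_momentumReversal (x : PhaseSpace N) {t : ℝ}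
    (ht : 0 ≤ t) :
    (pinnedChain ω₂ lam β 0).chainFlow N
      (((pinnedChain ω₂ lam β 0).chainFlow N (x.1, -x.2) 0 t).1,
        -((pinnedChain ω₂ lam β 0).chainFlow N (x.1, -x.2) 0 t).2) 0 t = x := by
  set P := pinnedChain ω₂ lam β 0 with hP
  have hC : P.IsConfining := pinnedChain_isConfining hω hl hβ le_rfl
  set D : ConfinedDrift (P.drift N) := (hC.confinedDrift N).toConfinedDrift
  set D' : ConfinedDrift (fun z => -P.drift N z) := (hC.reversedDrift N).toConfinedDrift
  have h := D.flow_apply_flow_reverse D' (fun _ => rfl) x (n := 0) continuous_const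
    (fun _ => Submodule.zero_mem _) (fun _ => Submodule.zero_mem _) rfl ht
  have hrp : reversePath (0 : ℝ → PhaseSpace N) t = 0 := by funext s; simp
  rw [hrp, ← closedChainFlow_eq_drivenFlow, drivenFlow_neg_drift_eq hω hl hβ N _ ht] at h
  exact h

end Reversal

/-! ### Liouville: the closed flow preserves Lebesgue measure and every Gibbs weight -/

/-- The Gibbs weight density `e^{-H/T}` of the pinned chain is `ℝ≥0∞`-measurable. [folklore] -/
theorem measurable_gibbsWeightDensity (ω₂ lam β γ T : ℝ) (N : ℕ) :
    Measurable fun x : PhaseSpace N =>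
      ENNReal.ofReal (Real.exp (-(pinnedChain ω₂ lam β γ).hamiltonian N x / T)) :=
  (pinnedChain_continuous_gibbsDensity ω₂ lam β γ N T).measurable.ennreal_ofReal

section Liouville

variable {ω₂ lam β : ℝ} (hω : 0 < ω₂) (hl : 0 ≤ lam) (hβ : 0 ≤ β) {N : ℕ} (hN : 0 < N)
include hω hl hβ hN

omit hω hl hβ hN in
/-- A measure-preserving self-map that leaves a density invariant preserves the weighted measure:
`f_* μ = μ` and `ρ ∘ f = ρ` imply `f_* (ρ μ) = ρ μ`. [folklore] -/
theorem measurePreserving_withDensity_of_comp_eq {α : Type*} [MeasurableSpace α]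
    {μ : Measure α} {f : α → α} (hf : MeasurePreserving f μ μ) {ρ : α → ℝ≥0∞} (hρ : Measurable ρ)
    (hinv : ∀ x, ρ (f x) = ρ x) :
    MeasurePreserving f (μ.withDensity ρ) (μ.withDensity ρ) := by
  refine ⟨hf.measurable, Measure.ext fun A hA => ?_⟩
  rw [Measure.map_apply hf.measurable hA, withDensity_apply _ (hf.measurable hA), withDensity_apply _ hA,
    ← lintegral_indicator (hf.measurable hA), ← lintegral_indicator hA]
  have h1 : (fun x => (f ⁻¹' A).indicator ρ x) = fun x => A.indicator ρ (f x) := by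
    funext x
    by_cases hx : f x ∈ A
    · rw [Set.indicator_of_mem (show x ∈ f ⁻¹' A from hx), Set.indicator_of_mem hx, hinv]
    · rw [Set.indicator_of_notMem (show x ∉ f ⁻¹' A from hx), Set.indicator_of_notMem hx]
  rw [h1, ← lintegral_map (hρ.indicator hA) hf.measurable, hf.map_eq]


/-- **Liouville's theorem** for the closed chain: `φ_t` maps Lebesgue measure on phase space to itself
(`t ≥ 0`; divergence of the frictionless drift `= -2γ = 0`). [folklore] -/
theorem map_closedChainFlow_volume {t : ℝ} (ht : 0 ≤ t) :
    Measure.map (fun x => (pinnedChain ω₂ lam β 0).chainFlow N x 0 t) volume = volume := by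
  haveI := isAddHaarMeasure_volume_phaseSpace N
  set P := pinnedChain ω₂ lam β 0 with hP
  rcases eq_or_lt_of_le ht with ht0 | ht0
  · have : (fun x => P.chainFlow N x 0 t) = id := funext fun x => by
      rw [← ht0]; exact closedChainFlow_zero N x
    rw [this, Measure.map_id]
  have hC : P.IsConfining := pinnedChain_isConfining hω hl hβ le_rfl
  set D : ConfinedDrift (P.drift N) := (hC.confinedDrift N).toConfinedDrift
  set D' : ConfinedDrift (fun z => -P.drift N z) := (hC.reversedDrift N).toConfinedDrift
  have hdiv : ∀ y, LinearMap.trace ℝ (PhaseSpace N)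
      (fderiv ℝ (P.drift N) y : PhaseSpace N →ₗ[ℝ] PhaseSpace N) = 0 := fun y => by
    rw [P.trace_fderiv_drift (pinnedChain_contDiff_U ω₂ lam β 0) (pinnedChain_contDiff_V ω₂ lam β 0) hN y]
    show -(2 * (0:ℝ)) = 0
    norm_num
  have h := D.map_flow_volume volume D' (fun _ => rfl) (n := 0) continuous_const
    (fun _ => Submodule.zero_mem _) (fun _ => Submodule.zero_mem _) rfl ht0 hdiv
  simp only [zero_mul, neg_zero, Real.exp_zero, ENNReal.ofReal_one, one_smul] at h
  have hfun : (fun x => drivenFlow (P.drift N) x 0 t) = fun x => P.chainFlow N x 0 t :=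
    funext fun x => (closedChainFlow_eq_drivenFlow N x t).symm
  rw [hfun] at h
  exact h

/-- The closed flow is measure preserving for Lebesgue measure (`t ≥ 0`). [folklore] -/
theorem measurePreserving_closedChainFlow_volume {t : ℝ} (ht : 0 ≤ t) :
    MeasurePreserving (fun x => (pinnedChain ω₂ lam β 0).chainFlow N x 0 t) volume volume :=
  ⟨(continuous_closedChainFlow_left hω hl hβ N t).measurable, map_closedChainFlow_volume hω hl hβ hN ht⟩

/-- **Liouville + energy conservation: the closed flow preserves every Gibbs weight** `e^{-H/T} dq dp`
(`t ≥ 0`, `N ≥ 1`, any `T`; the Hamiltonian of `pinnedChain ω₂ lam β γ` is that of the closed chain).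
[folklore] -/
theorem measurePreserving_closedChainFlow_gibbsWeight (γ T : ℝ) {t : ℝ} (ht : 0 ≤ t) :
    MeasurePreserving (fun x => (pinnedChain ω₂ lam β 0).chainFlow N x 0 t)
      (volume.withDensity fun x => ENNReal.ofReal (Real.exp (-(pinnedChain ω₂ lam β γ).hamiltonian N x / T)))
      (volume.withDensity fun x => ENNReal.ofReal (Real.exp (-(pinnedChain ω₂ lam β γ).hamiltonian N x / T))) :=
  measurePreserving_withDensity_of_comp_eq (measurePreserving_closedChainFlow_volume hω hl hβ hN ht)
    (measurable_gibbsWeightDensity ω₂ lam β γ T N) fun x => by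
      have : (pinnedChain ω₂ lam β γ).hamiltonian N = (pinnedChain ω₂ lam β 0).hamiltonian N := rfl
      simp only [this, hamiltonian_closedChainFlow hω hl hβ N x t]

omit hω hl hβ hN in
/-- **Momentum reversal preserves every Gibbs weight** (`H` is even in the momenta, Lebesgue measure is
reversal invariant). [folklore] -/
theorem measurePreserving_momentumReversal_gibbsWeight (ω₂ lam β γ T : ℝ) (N : ℕ) :
    MeasurePreserving (momentumReversal N)
      (volume.withDensity fun x => ENNReal.ofReal (Real.exp (-(pinnedChain ω₂ lam β γ).hamiltonian N x / T)))
      (volume.withDensity fun x => ENNReal.ofReal (Real.exp (-(pinnedChain ω₂ lam β γ).hamiltonian N x / T))) :=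
  measurePreserving_withDensity_of_comp_eq (measurePreserving_momentumReversal N)
    (measurable_gibbsWeightDensity ω₂ lam β γ T N) fun x => by
      simp only [momentumReversal_apply, OscillatorChain.hamiltonian_neg_momentum]

end Liouville


end Summit.AtomisticToContinuum.FouriersLaw.Theorems.ClosedChainFlow

end
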